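import Summits.QuantumAdvantage.AdviceFreeQNC0.ConstantBellsDense
import Literature.Computability.MetaComplexity.TwoModuliExpSums
import Mathlib.Analysis.SpecialFunctions.Complex.CircleAddChar
import HarnessLib

/-!
# Twisted transfer vectors: the correlation of a constant strategy's win indicator with a mod-`p` linear phase

Planner qa-qnc0-p2 g15's `TwistBound p` (ROUND-15 (p2) §3.11 step (ii), the only analytic input of rung R11'
`WalkHardFLinForms`): for an OBLIVIOUS firing set `Y`, charge `c` and a phase vector `β ∈ (ZMod p)ⁿ`,
`|Σ_u e_p(Σ_{i : u_i} β_i)·[WIN_Y(u)]| ≤ 3√6·cos(π/(3p))^{#supp β}·2ⁿ`.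

This file reduces it to a PER-SITE statement.  Writing `[WIN] = (1 − (−1)^N)/2` and `(−1)^{N(u)} = Σ_τ Π_j f^τ_j(s_j(u))`
(`ConstantBellsDense.sgnU_eq_sum`, walk states `s_j = j + W_j(u)`), both `Σ_u e_p(⟨β,u⟩)` and `Σ_u e_p(⟨β,u⟩)(−1)^{N(u)}` are
TWISTED path sums: the bit after cut `g` moves the state by `+1` (phase `1`) or `+2` (phase `ζ_g = e_p(β_g)`), so the backward
vector obeys `TBV_g = f_g · ½(TBV_{g+1}(·+1) + ζ_g·TBV_{g+1}(·+2))` (`twisted_pathSum_eq`).  If every site with `β_g ≠ 0`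
contracts the squared norm by `ρ²` (the hypothesis `hsite` — the `3×3` normal operator `½(S + ζS²)` has norm `cos(π/(3p))` for
`ζ = e_p(j)`, `j ≠ 0`, `3 ∤ p`; typed for the Literature by qn-lit), then `|Σ_u e_p(⟨β,u⟩)[WIN_Y(u)]| ≤ 3·ρ^{#supp β}·2ⁿ`
(`TwistedTransfer.corr_win_le`).
WHAT THIS IS NOT: the per-site trigonometric bound itself and R11' (regularisation, character expansion) are not here;
separation NOT moved.
-/

noncomputable section

namespace Summit.QuantumAdvantage.AdviceFreeQNC0

open Finset Literature.Computability.MetaComplexity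

namespace TwistedTransfer

open ConstBells

variable {n : ℕ}

/-! ### Complex vectors on `ZMod 3` and the twisted step -/

/-- Squared norm of a complex vector on `ZMod 3`. -/
def cnsq (v : ZMod 3 → ℂ) : ℝ := ‖v 0‖ ^ 2 + ‖v 1‖ ^ 2 + ‖v 2‖ ^ 2

/-- `cnsq` is nonnegative. -/
theorem cnsq_nonneg (v : ZMod 3 → ℂ) : 0 ≤ cnsq v := by unfold cnsq; positivity

/-- A coordinate is bounded by the norm. -/
theorem normSq_le_cnsq (v : ZMod 3 → ℂ) (s : ZMod 3) : ‖v s‖ ^ 2 ≤ cnsq v := by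
  unfold cnsq
  fin_cases s
  · show ‖v 0‖ ^ 2 ≤ _; nlinarith [sq_nonneg ‖v 1‖, sq_nonneg ‖v 2‖]
  · show ‖v 1‖ ^ 2 ≤ _; nlinarith [sq_nonneg ‖v 0‖, sq_nonneg ‖v 2‖]
  · show ‖v 2‖ ^ 2 ≤ _; nlinarith [sq_nonneg ‖v 0‖, sq_nonneg ‖v 1‖]

/-- The twisted step: `(T_ζ v)(s) = (v(s+1) + ζ·v(s+2))/2`. -/
def twAvg (ζ : ℂ) (v : ZMod 3 → ℂ) : ZMod 3 → ℂ := fun s => (v (s + 1) + ζ * v (s + 2)) / 2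

/-- Multiplication by a real factor family. -/
def rMul (d : ZMod 3 → ℝ) (v : ZMod 3 → ℂ) : ZMod 3 → ℂ := fun s => (d s : ℂ) * v s

/-- Addition table of `ZMod 3`, `+1`. -/
private theorem z3_add1' : ((0 : ZMod 3) + 1 = 1) ∧ ((1 : ZMod 3) + 1 = 2) ∧ ((2 : ZMod 3) + 1 = 0) := by decide
/-- Addition table of `ZMod 3`, `+2`. -/
private theorem z3_add2' : ((0 : ZMod 3) + 2 = 2) ∧ ((1 : ZMod 3) + 2 = 0) ∧ ((2 : ZMod 3) + 2 = 1) := by decide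

/-- The untwisted bound: a step with a phase of modulus `≤ 1` does not expand the norm. -/
theorem cnsq_twAvg_le {ζ : ℂ} (hζ : ‖ζ‖ ≤ 1) (v : ZMod 3 → ℂ) : cnsq (twAvg ζ v) ≤ cnsq v := by
  have hterm : ∀ a b : ℂ, ‖(a + ζ * b) / 2‖ ^ 2 ≤ (‖a‖ ^ 2 + ‖b‖ ^ 2) / 2 := by
    intro a b
    have h1 : ‖(a + ζ * b) / 2‖ ≤ (‖a‖ + ‖b‖) / 2 := by
      rw [norm_div, Complex.norm_ofNat]
      have : ‖a + ζ * b‖ ≤ ‖a‖ + ‖b‖ := by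
        calc ‖a + ζ * b‖ ≤ ‖a‖ + ‖ζ * b‖ := norm_add_le _ _
          _ ≤ ‖a‖ + ‖b‖ := by
            rw [norm_mul]; nlinarith [norm_nonneg b, norm_nonneg ζ]
      linarith
    have h0 : 0 ≤ ‖(a + ζ * b) / 2‖ := norm_nonneg _
    nlinarith [sq_nonneg (‖a‖ - ‖b‖)]
  unfold cnsq twAvg
  rw [z3_add1'.1, z3_add1'.2.1, z3_add1'.2.2, z3_add2'.1, z3_add2'.2.1, z3_add2'.2.2]
  have t0 := hterm (v 1) (v 2)
  have t1 := hterm (v 2) (v 0)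
  have t2 := hterm (v 0) (v 1)
  linarith

/-- A real factor family bounded by `1` does not expand the norm. -/
theorem cnsq_rMul_le {d : ZMod 3 → ℝ} (hd : ∀ s, d s ^ 2 ≤ 1) (v : ZMod 3 → ℂ) : cnsq (rMul d v) ≤ cnsq v := by
  have hterm : ∀ s, ‖(d s : ℂ) * v s‖ ^ 2 ≤ ‖v s‖ ^ 2 := by
    intro s
    rw [norm_mul, Complex.norm_real, mul_pow, Real.norm_eq_abs, sq_abs]
    nlinarith [hd s, sq_nonneg ‖v s‖]
  unfold cnsq rMul
  have t0 := hterm 0; have t1 := hterm 1; have t2 := hterm 2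
  linarith

/-! ### The twisted backward vector and path sum -/

/-- The twisted backward vector: `TBV 0 = f g`, `TBV (k+1) = f g · T_{ζ g}(TBV_{g+1} k)`. -/
def TBV (ζ : ℕ → ℂ) (f : ℕ → ZMod 3 → ℝ) : ℕ → ℕ → ZMod 3 → ℂ
  | g, 0 => fun s => (f g s : ℂ)
  | g, k + 1 => rMul (f g) (twAvg (ζ g) (TBV ζ f (g + 1) k))

/-- `TBV` with no step left. -/
theorem TBV_zero (ζ : ℕ → ℂ) (f : ℕ → ZMod 3 → ℝ) (g : ℕ) : TBV ζ f g 0 = fun s => (f g s : ℂ) := rfl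

/-- `TBV` recursion. -/
theorem TBV_succ (ζ : ℕ → ℂ) (f : ℕ → ZMod 3 → ℝ) (g k : ℕ) :
    TBV ζ f g (k + 1) = rMul (f g) (twAvg (ζ g) (TBV ζ f (g + 1) k)) := rfl

/-- `W_0 = 0`. -/
private theorem wtPrefix_zero₁ {m : ℕ} (u : Fin m → Bool) : wtPrefix u 0 = 0 := by
  unfold wtPrefix
  rw [Finset.card_eq_zero, Finset.filter_eq_empty_iff]
  intro i _ h
  exact absurd h.1 (Nat.not_lt_zero _)

/-- **Twisted path sum = twisted backward vector**: with phase `ζ_{g+i}` on the inputs with `u_i = 1`,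
`Σ_u (Π_{j ≤ k} f_{g+j}(s + j + W_j(u))) · Π_{i<k} ζ_{g+i}^{[u_i]} = 2^k · TBV_g k s`. -/
theorem twisted_pathSum_eq (ζ : ℕ → ℂ) (f : ℕ → ZMod 3 → ℝ) (k : ℕ) : ∀ (g : ℕ) (s : ZMod 3),
    (∑ u : Fin k → Bool, ((∏ j ∈ range (k + 1), f (g + j) (s + ((j + wtPrefix u j : ℕ) : ZMod 3)) : ℝ) : ℂ) *
        ∏ i : Fin k, (if u i then ζ (g + i.val) else 1)) =
      2 ^ k * TBV ζ f g k s := by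
  induction k with
  | zero =>
    intro g s
    rw [TBV_zero]
    simp [wtPrefix_zero₁]
  | succ k ih =>
    intro g s
    rw [TBV_succ]
    rw [← Fintype.sum_equiv (Fin.consEquiv fun _ : Fin (k + 1) => Bool)
      (fun p : Bool × (Fin k → Bool) => ((∏ j ∈ range (k + 1 + 1),
        f (g + j) (s + ((j + wtPrefix (Fin.cons p.1 p.2 : Fin (k + 1) → Bool) j : ℕ) : ZMod 3)) : ℝ) : ℂ) *
        ∏ i : Fin (k + 1), (if (Fin.cons p.1 p.2 : Fin (k + 1) → Bool) i then ζ (g + i.val) else 1))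
      _ (fun p => rfl), Fintype.sum_prod_type]
    have hinner : ∀ b : Bool, (∑ u' : Fin k → Bool, ((∏ j ∈ range (k + 1 + 1),
        f (g + j) (s + ((j + wtPrefix (Fin.cons b u' : Fin (k + 1) → Bool) j : ℕ) : ZMod 3)) : ℝ) : ℂ) *
        ∏ i : Fin (k + 1), (if (Fin.cons b u' : Fin (k + 1) → Bool) i then ζ (g + i.val) else 1)) =
        (f g s : ℂ) * (if b then ζ g else 1) * (2 ^ k * TBV ζ f (g + 1) k (s + 1 + ((b.toNat : ℕ) : ZMod 3))) := by
      intro b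
      rw [← ih (g + 1) (s + 1 + ((b.toNat : ℕ) : ZMod 3)), Finset.mul_sum]
      refine Finset.sum_congr rfl fun u' _ => ?_
      rw [Finset.prod_range_succ' _ (k + 1), Fin.prod_univ_succ]
      simp only [Fin.cons_zero, Fin.cons_succ, Fin.val_zero, add_zero, Fin.val_succ]
      have hfac : ∀ j ∈ range (k + 1), f (g + (j + 1)) (s + (((j + 1) +
          wtPrefix (Fin.cons b u' : Fin (k + 1) → Bool) (j + 1) : ℕ) : ZMod 3)) =
          f (g + 1 + j) (s + 1 + ((b.toNat : ℕ) : ZMod 3) + ((j + wtPrefix u' j : ℕ) : ZMod 3)) := by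
        intro j _
        rw [wtPrefix_cons_succ]
        congr 1
        · ring
        · push_cast; ring
      rw [Finset.prod_congr rfl hfac]
      simp only [wtPrefix_zero₁, Nat.cast_zero, add_zero]
      have hg : ∀ i : Fin k, g + (i.val + 1) = g + 1 + i.val := fun i => by ring
      simp only [hg]
      push_cast
      ring
    rw [Fintype.sum_bool, hinner true, hinner false]
    simp only [Bool.toNat_true, Bool.toNat_false, Nat.cast_one, Nat.cast_zero, add_zero, if_true,
      Bool.false_eq_true, if_false]
    unfold rMul twAvg
    rw [show s + 1 + (1 : ZMod 3) = s + 2 from by ring]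
    ring

/-! ### Norm propagation -/

/-- One step: `‖TBV_g (k+1)‖² ≤ ρ_g² · ‖TBV_{g+1} k‖²` when site `g` contracts by `ρ_g` and the factors are bounded by `1`. -/
theorem cnsq_TBV_succ_le (ζ : ℕ → ℂ) (f : ℕ → ZMod 3 → ℝ) (hf : ∀ g s, f g s ^ 2 ≤ 1) (ρ : ℕ → ℝ)
    (hρ : ∀ g v, cnsq (twAvg (ζ g) v) ≤ ρ g ^ 2 * cnsq v) (g k : ℕ) :
    cnsq (TBV ζ f g (k + 1)) ≤ ρ g ^ 2 * cnsq (TBV ζ f (g + 1) k) := by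
  rw [TBV_succ]
  exact (cnsq_rMul_le (hf g) _).trans (hρ g _)

/-- Along the whole walk: `‖TBV_g k‖² ≤ (Π_{i<k} ρ_{g+i}²) · ‖f_{g+k}‖²`. -/
theorem cnsq_TBV_le (ζ : ℕ → ℂ) (f : ℕ → ZMod 3 → ℝ) (hf : ∀ g s, f g s ^ 2 ≤ 1) (ρ : ℕ → ℝ)
    (hρ : ∀ g v, cnsq (twAvg (ζ g) v) ≤ ρ g ^ 2 * cnsq v) (k : ℕ) :
    ∀ g, cnsq (TBV ζ f g k) ≤ (∏ i ∈ range k, ρ (g + i) ^ 2) * cnsq (TBV ζ f (g + k) 0) := by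
  induction k with
  | zero => intro g; simp
  | succ k ih =>
    intro g
    have hnonneg : 0 ≤ ρ g ^ 2 := sq_nonneg _
    calc cnsq (TBV ζ f g (k + 1)) ≤ ρ g ^ 2 * cnsq (TBV ζ f (g + 1) k) := cnsq_TBV_succ_le ζ f hf ρ hρ g k
      _ ≤ ρ g ^ 2 * ((∏ i ∈ range k, ρ (g + 1 + i) ^ 2) * cnsq (TBV ζ f (g + 1 + k) 0)) :=
          mul_le_mul_of_nonneg_left (ih (g + 1)) hnonneg
      _ = (∏ i ∈ range (k + 1), ρ (g + i) ^ 2) * cnsq (TBV ζ f (g + (k + 1)) 0) := by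
          rw [Finset.prod_range_succ', add_zero, show g + 1 + k = g + (k + 1) from by ring]
          have : ∀ i ∈ range k, ρ (g + 1 + i) ^ 2 = ρ (g + (i + 1)) ^ 2 := fun i _ => by rw [show g + 1 + i = g + (i + 1) from by ring]
          rw [Finset.prod_congr rfl this]; ring

/-! ### The correlation bound -/

/-- The norm of a real vector seen in `ℂ`. -/
theorem cnsq_ofReal (w : ZMod 3 → ℝ) : cnsq (fun s => (w s : ℂ)) = nsq w := by
  unfold cnsq nsq
  simp only [Complex.norm_real, Real.norm_eq_abs, sq_abs]

/-- The empty strategy never wins: `sgnU c ∅ u = 1`. -/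
theorem sgnU_empty (c : ℕ) (u : Fin n → Bool) : sgnU c (∅ : Finset (Fin (n + 1))) u = 1 := by
  unfold sgnU ringWinU constY
  simp

/-- The win indicator through the sign: `[WIN] = (1 − sgnU)/2`. -/
theorem win_indicator_eq (c : ℕ) (Y : Finset (Fin (n + 1))) (u : Fin n → Bool) :
    (if ringWinU c (fun g _ => decide (g ∈ Y)) u = true then (1 : ℂ) else 0) = (1 - (sgnU c Y u : ℂ)) / 2 := by
  unfold sgnU constY
  split_ifs <;> norm_num

section Site

variable {p : ℕ} [Fact p.Prime]

/-- The site phases `ζ_i = e_p(β_i)` (and `1` beyond the input length). -/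
def phase (β : Fin n → ZMod p) (i : ℕ) : ℂ := if h : i < n then (ZMod.stdAddChar (β ⟨i, h⟩) : ℂ) else 1

/-- The linear phase of an input is the product of the site phases of its set bits. -/
theorem char_eq_prod (β : Fin n → ZMod p) (u : Fin n → Bool) :
    (ZMod.stdAddChar (∑ i : Fin n, if u i then β i else 0) : ℂ) = ∏ i : Fin n, (if u i then phase β i.val else 1) := by
  rw [Literature.Computability.MetaComplexity.TwoModuli.stdAddChar_sum_ite β u]
  refine Finset.prod_congr rfl fun i _ => ?_
  unfold phase
  by_cases hu : u i = true
  · rw [if_pos hu, if_pos hu, dif_pos i.isLt]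
  · rw [if_neg hu, if_neg hu]

/-- The per-site contraction factors. -/
def siteRho (β : Fin n → ZMod p) (ρ : ℝ) (i : ℕ) : ℝ :=
  if h : i < n then (if β ⟨i, h⟩ = 0 then 1 else ρ) else 1

/-- `Π_{i<n} siteRho² = (ρ²)^{#supp β}`. -/
theorem prod_siteRho_sq (β : Fin n → ZMod p) (ρ : ℝ) :
    (∏ i ∈ range n, siteRho β ρ (0 + i) ^ 2) = (ρ ^ 2) ^ (univ.filter fun i : Fin n => β i ≠ 0).card := by
  classical
  simp only [zero_add]
  rw [← Fin.prod_univ_eq_prod_range (fun i => siteRho β ρ i ^ 2) n]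
  have h : ∀ i : Fin n, siteRho β ρ i.val ^ 2 = if β i ≠ 0 then ρ ^ 2 else 1 := by
    intro i
    unfold siteRho
    rw [dif_pos i.isLt]
    by_cases hb : β i = 0
    · rw [if_pos hb, if_neg (not_not.2 hb), one_pow]
    · rw [if_neg hb, if_pos hb]
  rw [Finset.prod_congr rfl (fun i _ => h i), Finset.prod_ite, Finset.prod_const, Finset.prod_const_one, mul_one]

/-- The twisted sum `Σ_u sgnU(u)·e_p(⟨β,u⟩)` of a constant strategy `B` in transfer form. -/
theorem sum_sgnU_char (c : ℕ) (B : Finset (Fin (n + 1))) (β : Fin n → ZMod p) :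
    (∑ u : Fin n → Bool, (sgnU c B u : ℂ) * ∏ i : Fin n, (if u i then phase β i.val else 1)) =
      ∑ τ : ZMod 3, (2 : ℂ) ^ n * TBV (phase β) (fT (bellsN B) n (((c + 2 * n : ℕ) : ZMod 3)) τ) 0 n 0 := by
  have h : ∀ u : Fin n → Bool, (sgnU c B u : ℂ) * ∏ i : Fin n, (if u i then phase β i.val else 1) =
      ∑ τ : ZMod 3, ((∏ j ∈ range (n + 1), fT (bellsN B) n (((c + 2 * n : ℕ) : ZMod 3)) τ (0 + j)
        (0 + ((j + wtPrefix u j : ℕ) : ZMod 3)) : ℝ) : ℂ) * ∏ i : Fin n, (if u i then phase β (0 + i.val) else 1) := by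
    intro u
    rw [sgnU_eq_sum, Complex.ofReal_sum, Finset.sum_mul]
    simp only [zero_add]
    rfl
  simp_rw [h]
  rw [Finset.sum_comm]
  refine Finset.sum_congr rfl fun τ _ => ?_
  exact twisted_pathSum_eq (phase β) _ n 0 0

/-- The bound on one twisted transfer vector: `|TBV_0(0)| ≤ ρ^{#supp β}`. -/
theorem norm_TBV_le {ρ : ℝ} (hρ : 0 ≤ ρ)
    (hsite : ∀ a : ZMod p, a ≠ 0 → ∀ v : ZMod 3 → ℂ, cnsq (twAvg (ZMod.stdAddChar a) v) ≤ ρ ^ 2 * cnsq v)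
    (β : Fin n → ZMod p) (BN : Finset ℕ) (κ τ : ZMod 3) :
    ‖TBV (phase β) (fT BN n κ τ) 0 n 0‖ ≤ ρ ^ (univ.filter fun i : Fin n => β i ≠ 0).card := by
  have hρsite : ∀ g v, cnsq (twAvg (phase β g) v) ≤ siteRho β ρ g ^ 2 * cnsq v := by
    intro g v
    unfold phase siteRho
    by_cases hg : g < n
    · rw [dif_pos hg, dif_pos hg]
      by_cases hb : β ⟨g, hg⟩ = 0
      · rw [if_pos hb, hb, AddChar.map_zero_eq_one, one_pow, one_mul]
        exact cnsq_twAvg_le (by simp) v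
      · rw [if_neg hb]
        exact hsite _ hb v
    · rw [dif_neg hg, dif_neg hg, one_pow, one_mul]
      exact cnsq_twAvg_le (by simp) v
  have h1 := cnsq_TBV_le (phase β) (fT BN n κ τ) (fT_sq_le BN n κ τ) (siteRho β ρ) hρsite n 0
  rw [prod_siteRho_sq, zero_add, TBV_zero, cnsq_ofReal] at h1
  have h2 : cnsq (TBV (phase β) (fT BN n κ τ) 0 n) ≤ (ρ ^ 2) ^ (univ.filter fun i : Fin n => β i ≠ 0).card := by
    refine h1.trans ?_
    have := nsq_fT_last BN n κ τ
    have h0 : 0 ≤ (ρ ^ 2) ^ (univ.filter fun i : Fin n => β i ≠ 0).card := by positivity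
    nlinarith
  have h3 : ‖TBV (phase β) (fT BN n κ τ) 0 n 0‖ ^ 2 ≤ (ρ ^ (univ.filter fun i : Fin n => β i ≠ 0).card) ^ 2 := by
    rw [← pow_mul, mul_comm, pow_mul]
    exact (normSq_le_cnsq _ 0).trans h2
  have h4 := abs_le_of_sq_le_sq h3 (by positivity)
  rwa [abs_norm] at h4

/-- The twisted sum of a constant strategy is small: `|Σ_u sgnU(u) e_p(⟨β,u⟩)| ≤ 3·ρ^{#supp β}·2ⁿ`. -/
theorem norm_sum_sgnU_char_le {ρ : ℝ} (hρ : 0 ≤ ρ)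
    (hsite : ∀ a : ZMod p, a ≠ 0 → ∀ v : ZMod 3 → ℂ, cnsq (twAvg (ZMod.stdAddChar a) v) ≤ ρ ^ 2 * cnsq v)
    (c : ℕ) (B : Finset (Fin (n + 1))) (β : Fin n → ZMod p) :
    ‖∑ u : Fin n → Bool, (sgnU c B u : ℂ) * ∏ i : Fin n, (if u i then phase β i.val else 1)‖ ≤
      3 * ρ ^ (univ.filter fun i : Fin n => β i ≠ 0).card * (2 : ℝ) ^ n := by
  rw [sum_sgnU_char]
  set s := (univ.filter fun i : Fin n => β i ≠ 0).card
  have hτ : ∀ τ : ZMod 3, ‖(2 : ℂ) ^ n * TBV (phase β) (fT (bellsN B) n (((c + 2 * n : ℕ) : ZMod 3)) τ) 0 n 0‖ ≤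
      (2 : ℝ) ^ n * ρ ^ s := by
    intro τ
    rw [norm_mul, norm_pow, Complex.norm_ofNat]
    exact mul_le_mul_of_nonneg_left (norm_TBV_le hρ hsite β _ _ τ) (by positivity)
  have h3 : (∑ τ : ZMod 3, ‖(2 : ℂ) ^ n * TBV (phase β) (fT (bellsN B) n (((c + 2 * n : ℕ) : ZMod 3)) τ) 0 n 0‖) =
      ‖(2 : ℂ) ^ n * TBV (phase β) (fT (bellsN B) n (((c + 2 * n : ℕ) : ZMod 3)) 0) 0 n 0‖ +
      ‖(2 : ℂ) ^ n * TBV (phase β) (fT (bellsN B) n (((c + 2 * n : ℕ) : ZMod 3)) 1) 0 n 0‖ +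
      ‖(2 : ℂ) ^ n * TBV (phase β) (fT (bellsN B) n (((c + 2 * n : ℕ) : ZMod 3)) 2) 0 n 0‖ :=
    Fin.sum_univ_three _
  refine (norm_sum_le _ _).trans ?_
  rw [h3]
  have t0 := hτ 0; have t1 := hτ 1; have t2 := hτ 2
  linarith

/-- **Correlation bound from the per-site contraction**: if every nonzero phase `e_p(a)` makes the twisted step a
`ρ`-contraction of `ℂ^{ℤ/3}`, then for every oblivious firing set `Y`, charge `c` and phase vector `β`,
`|Σ_u [WIN_Y(u)]·e_p(⟨β,u⟩)| ≤ 3·ρ^{#supp β}·2ⁿ`. -/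
theorem corr_win_le {ρ : ℝ} (hρ : 0 ≤ ρ)
    (hsite : ∀ a : ZMod p, a ≠ 0 → ∀ v : ZMod 3 → ℂ, cnsq (twAvg (ZMod.stdAddChar a) v) ≤ ρ ^ 2 * cnsq v)
    (c : ℕ) (Y : Finset (Fin (n + 1))) (β : Fin n → ZMod p) :
    ‖∑ u : Fin n → Bool, (if ringWinU c (fun g _ => decide (g ∈ Y)) u = true then (1 : ℂ) else 0) *
        (ZMod.stdAddChar (∑ i : Fin n, if u i then β i else 0) : ℂ)‖ ≤
      3 * ρ ^ (univ.filter fun i : Fin n => β i ≠ 0).card * (2 : ℝ) ^ n := by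
  set s := (univ.filter fun i : Fin n => β i ≠ 0).card with hs
  -- rewrite the summand
  have hterm : ∀ u : Fin n → Bool, (if ringWinU c (fun g _ => decide (g ∈ Y)) u = true then (1 : ℂ) else 0) *
      (ZMod.stdAddChar (∑ i : Fin n, if u i then β i else 0) : ℂ) =
      (1 / 2) * ((sgnU c (∅ : Finset (Fin (n + 1))) u : ℂ) * ∏ i : Fin n, (if u i then phase β i.val else 1)) -
      (1 / 2) * ((sgnU c Y u : ℂ) * ∏ i : Fin n, (if u i then phase β i.val else 1)) := by
    intro u
    rw [win_indicator_eq, char_eq_prod, sgnU_empty]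
    push_cast; ring
  simp_rw [hterm]
  rw [Finset.sum_sub_distrib, ← Finset.mul_sum, ← Finset.mul_sum]
  have hA := norm_sum_sgnU_char_le hρ hsite c (∅ : Finset (Fin (n + 1))) β
  have hB := norm_sum_sgnU_char_le hρ hsite c Y β
  calc ‖(1 / 2 : ℂ) * (∑ u : Fin n → Bool, (sgnU c (∅ : Finset (Fin (n + 1))) u : ℂ) *
          ∏ i : Fin n, (if u i then phase β i.val else 1)) -
        (1 / 2 : ℂ) * (∑ u : Fin n → Bool, (sgnU c Y u : ℂ) * ∏ i : Fin n, (if u i then phase β i.val else 1))‖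
      ≤ ‖(1 / 2 : ℂ) * (∑ u : Fin n → Bool, (sgnU c (∅ : Finset (Fin (n + 1))) u : ℂ) *
          ∏ i : Fin n, (if u i then phase β i.val else 1))‖ +
        ‖(1 / 2 : ℂ) * (∑ u : Fin n → Bool, (sgnU c Y u : ℂ) * ∏ i : Fin n, (if u i then phase β i.val else 1))‖ :=
        norm_sub_le _ _
    _ ≤ 1 / 2 * (3 * ρ ^ s * (2 : ℝ) ^ n) + 1 / 2 * (3 * ρ ^ s * (2 : ℝ) ^ n) := by
        rw [norm_mul, norm_mul, show ‖(1 / 2 : ℂ)‖ = 1 / 2 from by norm_num]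
        gcongr
    _ = 3 * ρ ^ s * (2 : ℝ) ^ n := by ring

end Site

end TwistedTransfer

end Summit.QuantumAdvantage.AdviceFreeQNC0

end
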